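import Summits.ResolutionOfSingularities.ResolutionOfSingularities.Theorems.FrobeniusClosingPatchingRelPerfectSliceOfEngine
import Summits.ResolutionOfSingularities.ResolutionOfSingularities.Theorems.FrobeniusClosingPatchingRelPerfectOfAtomDimFour
import Summits.ResolutionOfSingularities.ResolutionOfSingularities.Theorems.FrobeniusClosingPatchingRelPerfectAtomOfAdmitsDesing
import Literature.Barriers.ResolutionOfSingularities.DimensionFourFrontier
import HarnessLib

/-!
# Crux `PatchingRelPerfect` (stmt-ResolutionOfSingularities-16161), chain w52, task W3:
# the DIMENSION-4 PERFECT-FIELD RUNG in the vocabulary of the barrier `DimensionFourFrontier`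

[OURS · L1 W5.2 · W3] The barrier file `Literature/Barriers/ResolutionOfSingularities/
DimensionFourFrontier.lean` isolates the two inputs missing at dimension `4`:
`LocalUniformizationUpToDim k 4` (LU₄) and `ZariskiPatchingUpToDim 4`
(`∀ k, ResolutionOverUpToDim k 3 → LocalUniformizationUpToDim k 4 → ResolutionOverUpToDim k 4`,
quantified over ALL fields `k`).  This file proves the PERFECT-FIELD RESTRICTION of the patching
input modulo the printed dimension-`≤ 3` theorems and the registered open atom
`stub_atomDimFour` of line `closed-point-slice` (equivalently, by W1, modulo "every sandwiched
fourfold germ at a perfect closed point admits a Temkin desingularization"):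

* `hasResolution_projective_of_dim_le_four_of_lu4` — the engine's projective step
  (`PatchingRelPerfect.SliceOfEngine.hasResolution_projective_of_dim_le_four`) re-run with the
  PER-FIELD, DIMENSION-BOUNDED hypothesis `LocalUniformizationUpToDim k 4` in place of relative
  LU for all function fields over `k` (the engine only uniformizes affine models of the ONE
  function field `K = k(X)`, `trdeg_k K = 4`, whose models have dimension `4`);
* `resolutionOverUpToDim_four_perfect_of_printed_of_atomDimFour` — for `k` perfect of
  characteristic `p`: printed inputs + atom at `p` + `LocalUniformizationUpToDim k 4` ⟹
  `ResolutionOverUpToDim k 4`;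
* `zariskiPatchingUpToDim_four_perfect_of_printed_of_atomDimFour` — the same in the literal
  shape of `ZariskiPatchingUpToDim 4` restricted to perfect fields of characteristic `p` (its
  hypothesis `ResolutionOverUpToDim k 3` is idle: the printed `CossartPiltant2019General` is
  stronger);
* `resolutionOverUpToDim_four_perfect_of_namedFacts_of_admitsDesingFour` — the same with the
  three NAMED FACTS and W1's desingularization statement in place of printed inputs + atom.

So, over PERFECT fields, `DimensionFourFrontier`'s isolated global input is met modulo the atom
(the dimension-`≥ 5` residual `stub_dimGeFive` is NOT used).  `ZariskiPatchingUpToDim 4` itself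
quantifies over all fields; for imperfect `k` nothing is claimed here (the twin crux `PatchingRel`
stmt-0642).  CONDITIONAL results; the item stays open.  Nothing here is a statement of the
manuscript under review.

## References

* O. Piltant, RACSAM 107 (2013), Prop. 5.1, Cor. 5.7, p. 2. [Piltant2013]
* O. Zariski, Ann. of Math. 45 (1944), p. 539. [Zariski1944]
* V. Cossart, O. Piltant, J. Algebra 529 (2019), Thm. 1.1, Prop. 4.4. [CossartPiltant2019]
* V. Cossart, U. Jannsen, S. Saito, LNM 2270 (2020), Thm. 1.2. [CossartJannsenSaito2020]
* S. D. Cutkosky, H. Mourtada, in *Singularities, Algebraic Geometry, Commutative Algebra…*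
  (2019), §1. [CutkoskyMourtada2019]
-/

-- `Summit.<Summit>.<Sub>.Theorems` with `Sub = Summit` (single-conjunct summit, D-0017)
set_option linter.dupNamespace false

noncomputable section

open CategoryTheory CategoryTheory.Limits AlgebraicGeometry Literature.AlgebraicGeometry.Resolution
open Literature.AlgebraicGeometry (Motives.projectiveSpace Motives.isProper_projectiveSpace
  Motives.IsProjectiveOver)
open Literature.Barriers.ResolutionOfSingularities (LocalUniformizationUpToDim)
open TopologicalSpace IsLocalRing

namespace Summit.ResolutionOfSingularities.ResolutionOfSingularities.Theorems

namespace PatchingRelPerfect.SliceOfEngine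

variable {k K : Type} [Field k] [Field K] [Algebra k K]

/-- **The engine's projective step under LU₄ at one field.** For `k` a field with
`LocalUniformizationUpToDim k 4` and the roof engine over `k` (`hR`), every integral closed
subscheme `X ⊆ ℙⁿ_k` of dimension `≤ 4` has a resolution of singularities, modulo
`CossartPiltant2019` (dimension `≤ 3`). Verbatim the proof of
`hasResolution_projective_of_dim_le_four`, except that local uniformization is invoked only for
affine models `R` of the function field `K = k(X)` with `trdeg_k K = 4`, which have
`dim R = trdeg_k K = 4` (`exists_ringKrullDim_eq_and_trdeg_eq`, `trdeg_eq_trdeg_of_isFractionRing`),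
so the dimension-bounded per-field hypothesis suffices.
[cite: Piltant2013, Prop. 5.1 and Cor. 5.7; Zariski1944, p. 539] -/
theorem hasResolution_projective_of_dim_le_four_of_lu4 (hCP : CossartPiltant2019.{0}) {k : Type}
    [Field k] (hLU4 : Literature.Barriers.ResolutionOfSingularities.LocalUniformizationUpToDim.{0} k 4)
    (hR : ∀ (M : Scheme.{0}) (g : M ⟶ Spec (.of k)) [IsSeparated g] [LocallyOfFiniteType g]
      [QuasiCompact g] [IsIntegral M], topologicalKrullDim M = 4 →
      (∀ m : M, IsClosed ({m} : Set M) →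
        ∃ (N : Scheme.{0}) (gN : N ⟶ Spec (.of k)) (q : M ⟶ N),
          IsSeparated gN ∧ LocallyOfFiniteType gN ∧ QuasiCompact gN ∧ IsIntegral N ∧
          q ≫ gN = g ∧ IsProper q ∧ IsBirational q ∧ topologicalKrullDim N ≤ 4 ∧
          IsRegularLocalRing (N.presheaf.stalk (q.base m))) →
      Scheme.HasResolution M)
    {n : ℕ} (X : Scheme.{0}) [IsIntegral X] (ι : X ⟶ (Motives.projectiveSpace n k).left)
    [IsClosedImmersion ι] (hX : topologicalKrullDim X ≤ ((4 : ℕ) : WithBot ℕ∞)) :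
    Scheme.HasResolution X := by
  classical
  haveI : IsProper (Motives.projectiveSpace n k).hom := Motives.isProper_projectiveSpace n k
  let πX : X ⟶ Spec (.of k) := ι ≫ (Motives.projectiveSpace n k).hom
  have hproj : Motives.IsProjectiveOver (Over.mk πX) := ⟨n, Over.homMk ι rfl, ‹_›⟩
  haveI : LocallyOfFiniteType πX := inferInstance
  -- an affine chart `U = Spec A` of `X`
  obtain ⟨_, ⟨U', hU', rfl⟩, hηU, -⟩ := X.isBasis_affineOpens.exists_subset_of_mem_open
    (Set.mem_univ (genericPoint X)) isOpen_univ
  let U : X.Opens := U'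
  have hU : IsAffineOpen U := hU'
  haveI : IsAffine U := hU
  haveI : Nonempty U := ⟨⟨_, hηU⟩⟩
  let A : Type := Γ(U, ⊤)
  -- `A` is a finitely generated `k`-algebra
  let g : (U : Scheme.{0}) ⟶ Spec (.of k) := U.ι ≫ πX
  let ψ : k →+* A := g.appTop.hom.comp (Scheme.ΓSpecIso (.of k)).inv.hom
  have hψ : ψ.FiniteType := by
    have h1 : g.appTop.hom.FiniteType :=
      (HasRingHomProperty.iff_of_isAffine (P := @LocallyOfFiniteType)).mp inferInstance
    exact h1.comp (RingHom.FiniteType.of_surjective _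
      (Scheme.ΓSpecIso (.of k)).symm.commRingCatIsoToRingEquiv.surjective)
  letI : Algebra k A := ψ.toAlgebra
  haveI hft : Algebra.FiniteType k A := hψ
  -- its fraction field `K`, and `X` as a projective model of `K/k`
  let K : Type := FractionRing A
  let j : Spec (.of A) ⟶ X := U.toScheme.isoSpec.inv ≫ U.ι
  have hj : j ≫ πX = Spec.map (CommRingCat.ofHom (algebraMap k A)) := by
    change (U.toScheme.isoSpec.inv ≫ U.ι) ≫ πX = Spec.map (CommRingCat.ofHom ψ)
    rw [Category.assoc, isoSpec_inv_comp]
    rfl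
  let M₀ : ProjModel k K := ProjModel.ofChart (K := K) X πX hproj A j hj
  -- `A` as a subalgebra `A₀ ⊆ K`, finitely generated with `Frac A₀ = K`
  let toK : A →ₐ[k] K := IsScalarTower.toAlgHom k A K
  let A₀ : Subalgebra k K := toK.range
  have hA₀fg : A₀.FG := by
    rw [show A₀ = Subalgebra.map toK ⊤ from (Algebra.map_top toK).symm]
    exact Subalgebra.FG.map toK hft.out
  haveI hA₀fr : IsFractionRing A₀ K := by
    refine IsFractionRing.of_field A₀ K fun z => ?_
    obtain ⟨a, b, -, rfl⟩ := IsFractionRing.div_surjective (A := A) z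
    exact ⟨⟨algebraMap A K a, a, rfl⟩, ⟨algebraMap A K b, b, rfl⟩, rfl⟩
  -- `trdeg_k K` is a natural number `m`, and `dim X = m`
  haveI : Algebra.FiniteType k A₀ := A₀.fg_iff_finiteType.mp hA₀fg
  obtain ⟨m, -, htrA₀⟩ := exists_ringKrullDim_eq_and_trdeg_eq k A₀
  have hKm : Algebra.trdeg k K = m := (trdeg_eq_trdeg_of_isFractionRing A₀).trans htrA₀
  have hXm : topologicalKrullDim X = m :=
    Pialt.OpenRange.properModel_topologicalKrullDim_eq_of_trdeg M₀.toProperModel hKm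
  by_cases hm3 : m ≤ 3
  · -- dimension `≤ 3`: Cossart–Piltant
    have h3 : topologicalKrullDim X ≤ 3 := by
      rw [hXm]
      exact_mod_cast hm3
    exact hCP k X πX inferInstance inferInstance inferInstance inferInstance h3
  -- dimension `4`
  have hm4 : m ≤ 4 := by
    have h : (m : WithBot ℕ∞) ≤ ((4 : ℕ) : WithBot ℕ∞) := hXm ▸ hX
    exact_mod_cast h
  have hm : m = 4 := by omega
  subst hm
  -- (LU₄) at `k`, for THIS `K` (`trdeg_k K = 4`), in the fibrewise shape: an affine model `R` of
  -- `K/k` has `dim R = trdeg_k K = 4 ≤ 4`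
  have hLU : ∀ (O : ValuationSubring K) (R : Subalgebra k K), R.FG → IsFractionRing R K →
      R.toSubring ≤ O.toSubring → ∃ (A : Subalgebra k K) (h : A.toSubring ≤ O.toSubring),
        R ≤ A ∧ A.FG ∧ IsRegularLocalRing (Localization.AtPrime
          (Ideal.comap (Subring.inclusion h) (IsLocalRing.maximalIdeal O))) := by
    intro O R hRfg hRfr hRO
    haveI : Algebra.FiniteType k R := R.fg_iff_finiteType.mp hRfg
    haveI := hRfr
    obtain ⟨s, hs, htrR⟩ := exists_ringKrullDim_eq_and_trdeg_eq k R
    have hs4 : (s : Cardinal) = ((4 : ℕ) : Cardinal) := by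
      rw [← htrR, ← trdeg_eq_trdeg_of_isFractionRing R, hKm]
    have hs4' : s = 4 := by exact_mod_cast hs4
    have hdimR : ringKrullDim R ≤ (4 : ℕ) := by rw [hs, hs4']
    exact hLU4 K O R hRO hRfg hRfr hdimR
  -- a finite resolving system of affine models, from (LU)
  have hcov : ∀ v : ZariskiRiemannSpace k K, ∃ T : Subalgebra k K,
      (T.FG ∧ IsFractionRing T K) ∧ ZariskiRiemannSpace.HasRegularCentre T v :=
    fun v => exists_hasRegularCentre_of_relLU hLU A₀ hA₀fg v
  obtain ⟨𝒯, h𝒯, h𝒯cov⟩ := exists_finite_resolvingSystem' (P := fun T => IsFractionRing T K)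
    (fun T hT => (isJ2Ring_of_field k).2 T ((Subalgebra.fg_iff_finiteType T).mp hT)) hcov
  -- their projective closures, as PROPER models: a finite resolving system of proper models
  have hM : ∀ T : ↥𝒯, ∃ M : ProperModel k K, ∀ w : ZariskiRiemannSpace k K,
      ZariskiRiemannSpace.HasRegularCentre T.1 w → M.RegCentre w := fun T => by
    haveI := (h𝒯 T.1 T.2).2
    obtain ⟨M, hM⟩ := ProjModel.exists_regCentre_of_hasRegularCentre T.1 (h𝒯 T.1 T.2).1
    exact ⟨M.toProperModel, fun w hw => (M.toProperModel_regCentre_iff w).mpr (hM w hw)⟩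
  choose M hM using hM
  let l : List (ProperModel k K) := 𝒯.attach.toList.map M
  have hlcov : ∀ v : ZariskiRiemannSpace k K, ∃ N ∈ l, N.RegCentre v := by
    intro v
    obtain ⟨T, hT, hTv⟩ := h𝒯cov v
    refine ⟨M ⟨T, hT⟩, ?_, hM ⟨T, hT⟩ v hTv⟩
    exact List.mem_map.mpr ⟨⟨T, hT⟩, Finset.mem_toList.mpr (Finset.mem_attach _ _), rfl⟩
  -- the iterated join of `M₀` with the resolving system
  obtain ⟨N, φ₀, hN⟩ := exists_hom_forall_nonempty_hom M₀.toProperModel l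
  -- `N` is an integral proper `k`-scheme of dimension `4` with regular roofs: the engine resolves it
  have hdimN : topologicalKrullDim N.X = 4 := by
    rw [Pialt.OpenRange.properModel_topologicalKrullDim_eq_of_trdeg N hKm]
    rfl
  have hresN : Scheme.HasResolution N.X :=
    hR N.X N.π hdimN fun x _ => exists_roof N hKm l hN hlcov x
  -- transfer to `X = M₀.X` along the proper birational domination `N → M₀`
  have hres₀ : Scheme.HasResolution M₀.toProperModel.X :=
    Scheme.HasResolution.of_isBirational φ₀.f φ₀.isBirational hresN
  exact hres₀

end PatchingRelPerfect.SliceOfEngine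

open PatchingRelPerfect.SliceOfEngine

/-- **W3 — the dimension-4 perfect-field rung.** For `p` prime and `k` PERFECT of characteristic
`p`: the printed dimension-`≤ 3` theorems (Cossart–Piltant 2019 Thm. 1.1 and Prop. 4.4;
Cossart–Jannsen–Saito 2020 Thm. 1.2 in single-blow-up format), the registered dimension-EXACTLY-4
atom `stub_atomDimFour` at `p` (open), and local uniformization up to dimension `4` over `k`
(`LocalUniformizationUpToDim k 4`, the barrier file's LU₄ at `k`) imply weak resolution up to
dimension `4` over `k` (`ResolutionOverUpToDim k 4`). Assembly: roof engine over `k` from the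
non-closed step (`stub_localDesingNonClosed`) and completion descent (`stub_algebraizeBlowup`) fed
with the full punctual atom (`punctualCompletePerfect_four_of_printed_of_atomDimFour`); reduction
to integral closed subschemes of `ℙⁿ_k` (`ResolutionOverUpToDim.of_projective`); projective step
under LU₄ (`hasResolution_projective_of_dim_le_four_of_lu4`). The dimension-`≥ 5` residual is not
used. CONDITIONAL. [cite: Piltant2013, Prop. 5.1, Cor. 5.7 and p. 2]
[cite: CossartPiltant2019, Thm. 1.1 and Prop. 4.4] [cite: Temkin2008, Prop. 2.3.4] -/
theorem resolutionOverUpToDim_four_perfect_of_printed_of_atomDimFour (p : ℕ) (hp : p.Prime)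
    (hG : CossartPiltant2019General.{0}) (hP : CossartPiltant2019Principalization.{0})
    (hCJS : ∀ (X : Scheme.{0}) [IsNoetherian X] [IsReduced X], Scheme.IsExcellent X →
      topologicalKrullDim X ≤ 2 → Scheme.AdmitsDesingularization X)
    (hA4 : ∀ (S : Type) [CommRing S] [IsRegularLocalRing S] [CharP S p]
      [IsAdicComplete (IsLocalRing.maximalIdeal S) S]
      [PerfectField (IsLocalRing.ResidueField S)], ringKrullDim S = (4 : ℕ) →
      ∀ (T : Scheme.{0}) (f : T ⟶ Spec (.of S)), IsIntegral T → IsProper f → IsBirational f →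
        (∀ t : T, f.base t ≠ IsLocalRing.closedPoint S → IsRegularLocalRing (T.presheaf.stalk t)) →
        ∃ (J : T.IdealSheafData) (T' : Scheme.{0}) (π : T' ⟶ T), J ≠ ⊥ ∧
          (∀ t : T, t ∈ J.support → f.base t = IsLocalRing.closedPoint S) ∧
          IsBlowup π J ∧ Scheme.IsRegular T')
    (k : Type) [Field k] [CharP k p] [PerfectField k] (hLU4 : LocalUniformizationUpToDim.{0} k 4) :
    ResolutionOverUpToDim.{0} k 4 := by
  have hCP : CossartPiltant2019.{0} := hG.cossartPiltant2019 Stacks07QW_field_holds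
  -- the roof engine over perfect fields of characteristic `p`, from printed inputs + the atom
  have hR : ∀ (k₁ : Type) [Field k₁] [CharP k₁ p] [PerfectField k₁] (M : Scheme.{0})
      (g : M ⟶ Spec (.of k₁)) [IsSeparated g] [LocallyOfFiniteType g] [QuasiCompact g]
      [IsIntegral M], topologicalKrullDim M = 4 →
      (∀ m : M, IsClosed ({m} : Set M) →
        ∃ (N : Scheme.{0}) (gN : N ⟶ Spec (.of k₁)) (q : M ⟶ N),
          IsSeparated gN ∧ LocallyOfFiniteType gN ∧ QuasiCompact gN ∧ IsIntegral N ∧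
          q ≫ gN = g ∧ IsProper q ∧ IsBirational q ∧ topologicalKrullDim N ≤ 4 ∧
          IsRegularLocalRing (N.presheaf.stalk (q.base m))) →
      Scheme.HasResolution M :=
    fun k₁ _ _ _ M g _ _ _ _ hdim hroof =>
      stub_roofEngine p hp
        (fun k₂ _ M₂ g₂ _ _ _ _ hdim₂ ζ hζ X' f' J hf' =>
          stub_localDesingNonClosed hG hP k₂ M₂ g₂ hdim₂ ζ hζ X' f' J hf')
        (fun k₃ _ _ _ S _ _ _ _ hdimS hfin T fT hT hfT hbir hoff =>
          @stub_algebraizeBlowup p hp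
            (fun S' _ _ _ _ _ hdim' T' f' hT' hf' hbir' hoff' =>
              @punctualCompletePerfect_four_of_printed_of_atomDimFour p hp hG hP hCJS hA4
                S' _ _ _ _ _ hdim' T' f' hT' hf' hbir' hoff')
            k₃ _ _ _ S _ _ _ _ hdimS hfin T fT hT hfT hbir hoff)
        k₁ M g hdim hroof
  exact ResolutionOverUpToDim.of_projective fun n Y ι hι hint hY => by
    haveI := hι
    haveI := hint
    exact hasResolution_projective_of_dim_le_four_of_lu4 hCP hLU4 (hR k) Y ι hY

/-- **W3 in the literal shape of the barrier's `ZariskiPatchingUpToDim 4`, restricted to PERFECT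
fields of characteristic `p`**, modulo the printed dimension-`≤ 3` theorems and the open atom at
`p`: `∀ k perfect of char p, ResolutionOverUpToDim k 3 → LocalUniformizationUpToDim k 4 →
ResolutionOverUpToDim k 4`. The first hypothesis is idle (the printed `CossartPiltant2019General`
already gives resolution up to dimension `3` over every field). `ZariskiPatchingUpToDim 4` itself
quantifies over ALL fields; this is only its perfect-field part. CONDITIONAL.
[cite: CutkoskyMourtada2019, §1] [cite: Piltant2013, p. 2] -/
theorem zariskiPatchingUpToDim_four_perfect_of_printed_of_atomDimFour (p : ℕ) (hp : p.Prime)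
    (hG : CossartPiltant2019General.{0}) (hP : CossartPiltant2019Principalization.{0})
    (hCJS : ∀ (X : Scheme.{0}) [IsNoetherian X] [IsReduced X], Scheme.IsExcellent X →
      topologicalKrullDim X ≤ 2 → Scheme.AdmitsDesingularization X)
    (hA4 : ∀ (S : Type) [CommRing S] [IsRegularLocalRing S] [CharP S p]
      [IsAdicComplete (IsLocalRing.maximalIdeal S) S]
      [PerfectField (IsLocalRing.ResidueField S)], ringKrullDim S = (4 : ℕ) →
      ∀ (T : Scheme.{0}) (f : T ⟶ Spec (.of S)), IsIntegral T → IsProper f → IsBirational f →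
        (∀ t : T, f.base t ≠ IsLocalRing.closedPoint S → IsRegularLocalRing (T.presheaf.stalk t)) →
        ∃ (J : T.IdealSheafData) (T' : Scheme.{0}) (π : T' ⟶ T), J ≠ ⊥ ∧
          (∀ t : T, t ∈ J.support → f.base t = IsLocalRing.closedPoint S) ∧
          IsBlowup π J ∧ Scheme.IsRegular T') :
    ∀ (k : Type) [Field k] [CharP k p] [PerfectField k],
      ResolutionOverUpToDim.{0} k 3 → LocalUniformizationUpToDim.{0} k 4 →
        ResolutionOverUpToDim.{0} k 4 :=
  fun k _ _ _ _ hLU4 =>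
    resolutionOverUpToDim_four_perfect_of_printed_of_atomDimFour p hp hG hP hCJS hA4 k hLU4

/-- **W3 ∘ W1 — the dimension-4 perfect-field rung from three NAMED FACTS and the open
desingularization statement for sandwiched fourfold germs**: for `p` prime and `k` perfect of
characteristic `p`, `CossartPiltant2019General`, `CossartPiltant2019Principalization`,
`CossartJannsenSaito2020Sequence` (named facts of the tree), "every integral `T` proper and
birational over a complete regular local `S` of dimension `4`, characteristic `p`, perfect
residue field, regular off the closed fibre, admits a Temkin desingularization" (OPEN), and
`LocalUniformizationUpToDim k 4` imply `ResolutionOverUpToDim k 4`. CONDITIONAL.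
[cite: CossartPiltant2019, Thm. 1.1 and Prop. 4.4] [cite: CossartJannsenSaito2020, Thm. 1.2]
[cite: Temkin2008, Def. 2.2.6] -/
theorem resolutionOverUpToDim_four_perfect_of_namedFacts_of_admitsDesingFour (p : ℕ)
    (hp : p.Prime) (hG : CossartPiltant2019General.{0})
    (hP : CossartPiltant2019Principalization.{0}) (hS : CossartJannsenSaito2020Sequence.{0})
    (hD : ∀ (S : Type) [CommRing S] [IsRegularLocalRing S] [CharP S p]
      [IsAdicComplete (IsLocalRing.maximalIdeal S) S]
      [PerfectField (IsLocalRing.ResidueField S)], ringKrullDim S = (4 : ℕ) →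
      ∀ (T : Scheme.{0}) (f : T ⟶ Spec (.of S)), IsIntegral T → IsProper f → IsBirational f →
        (∀ t : T, f.base t ≠ IsLocalRing.closedPoint S → IsRegularLocalRing (T.presheaf.stalk t)) →
        Scheme.AdmitsDesingularization T)
    (k : Type) [Field k] [CharP k p] [PerfectField k] (hLU4 : LocalUniformizationUpToDim.{0} k 4) :
    ResolutionOverUpToDim.{0} k 4 :=
  resolutionOverUpToDim_four_perfect_of_printed_of_atomDimFour p hp hG hP
    (cjs2020BlowupFormat_of_cossartJannsenSaito2020Sequence hS)
    (fun S _ _ _ _ _ hdim T f hT hf hbir hoff =>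
      @atomDimFour_of_admitsDesingularization S _ _ T f hT hoff (hD S hdim T f hT hf hbir hoff))
    k hLU4

end Summit.ResolutionOfSingularities.ResolutionOfSingularities.Theorems

end
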